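/-
Copyright: statement-level skeleton of a published paper (lit-balaban cell, Phase-2 proof seat p39 gen 8). No proof claims
beyond what the kernel checks below.
-/
import Literature.MathematicalPhysics.QuantumFieldTheory.Balaban1983to89.B3CxiLatticePairSums
import Literature.MathematicalPhysics.QuantumFieldTheory.Balaban1983to89.B3CxiAllSitesProfiles

/-!
# B3 — T. Bałaban, *(Higgs)₂,₃ quantum fields in a finite volume. III. Renormalization*, CMP **88** (1983) 411–445
[Balaban1983Higgs3], (3.26)–(3.27) pp. 440–441 [PDF 30–31]: the DISPLACEMENT-WEIGHTED kernel pairs of the first-curly-bracket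
function `Π_{μμ′ν}` — p. 441 *"Σ_x′ η^d tr q²[−(G∂^{η*}_{μ′})(x,x′)(G∂^{η*}_μ)(x′,x) + G(0;x,x′)(∂^η_{μ′}G∂^{η*}_μ)(x′,x)](x′_ν − x_ν)"* —
on the infinite lattice ξℤ³ for the free propagator `C^ξ`, with the displacement read EITHER as the ℤ³ coordinate `ξu_ν` (the print's
(3.27)) OR as the wrapped torus coordinate `ξ·valMinAbs(u_ν mod N)` (what the torus sum of the model unfolds to, file
`B3Pi3CxiTorusBounded`): all-sites profile bounds, summability, and the exponentially small BOUNDARY LAYER where the two readings differ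

statement-level skeleton of published theorems with citation tags; proofs where landed; nothing here is a claim about
the Yang–Mills mass gap

PDF held: `paper:balaban1983-higgs-2-3-quantum-fields-finite-volume` (journal page = PDF page + 410); pp. 440–442 [PDF 30–32] read on
the ×2 renders `run/shared/lean/pub/pub-balaban/b2b-balaban-ref1/pages/1983-cmp88-higgs23-III/1983-cmp88-higgs23-III-p030-x2.png` …
`-p032-x2.png`.  Row **B3.Eq3.25-3.32** of `HOME/lit-balaban-r15/ROWS-B3.md` (fold owner r15).  Toolkit file 4 of seat p39 gen 8
(after `B3ZdLatticeProfileSums`, `B3TorusKernelUnfolding`, `B3CxiLatticePairSums`), consumed by `B3Pi3CxiTorusBounded`.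
WHAT IS PROVED (`d = 3`, `0 < ξ ≤ 1`, profiles `(ξ max(1,|u|_∞))^{−q}e^{−ξ|u|_∞/2}` as in `B3CxiLatticePairSums`):
* §1 the wrapped displacement `ξ·valMinAbs(u_ν mod N)` and the ℤ³ one `ξu_ν`: both `≤ ξ|u|_∞` in absolute value, equal when
  `2|u|_∞ < N`, differing by at most `2ξ|u|_∞` (`abs_wrapDisp_le`, `abs_coordDisp_le`, `wrapDisp_sub_coordDisp_eq_zero`,
  `abs_wrapDisp_sub_coordDisp_le`).
* §2 `abs_mul_weight_le_profile` (a weight `≤ ξ|u|_∞` costs one profile power); `abs_d2Z_Cxi_le_profile`: p20's sharp all-sites bound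
  `|(∂^ξ_{μ′}∂^{ξ*}_μC^ξ)(u)| ≤ 61000·(ξ max(1,|u|_∞))^{−3}e^{−ξ|u|_∞/2}` (`B3CxiAllSitesProfiles`) in the `pdiffZ ∘ pdiffAdjZ` form of
  r15's `lhs327`, both index cases.
* §3 `boundary_summable_and_le`: for profile kernels of total order 4 and a correction `θ` supported on `2|u|_∞ ≥ N` with `|θ| ≤ 2ξ|u|_∞`,
  `ξ³Σ'_w|f(w)g(−w)θ(−w)| ≤ 26656·c_f c_g·e^{−ξN/4}` (`ξN ≥ 1`); `lhs327_zero_eq`: r15's left side of (3.27) at `y = 0` as the two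
  coordinate-weighted sections `−Σ'_w(∂^{ξ*}_{μ′}C^ξ)(w)(∂^{ξ*}_μC^ξ)(−w)ξ(−w)_ν + Σ'_wC^ξ(w)(∂^ξ_{μ′}∂^{ξ*}_μC^ξ)(−w)ξ(−w)_ν` (summable).
HONEST SCOPE: pure lattice analysis on ξℤ³ (no torus, no field); constants are generous, not optimal.  Mathlib + the cited tree files
only; theorems only, no definitions, no named facts; standard axioms.  Unit `lit-balaban-p39-g8` (Phase-2 proof seat p39, gen 8),
HOME `run/shared/lean/pub/lit-balaban/`, 2026-08-21.
-/

open scoped BigOperators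

namespace Literature.MathematicalPhysics.QuantumFieldTheory.Balaban1983to89.B3DisplacementWeightedPairSums

open B3Sect3VectorSelfEnergy B3CxiPropagator B3CxiUniformBound B3ZdLatticeProfileSums B3CxiLatticePairSums B3CxiAllSitesProfiles

noncomputable section

variable {d : ℕ} {ξ : ℝ}

/-! ## §1 The wrapped displacement and the ℤ³ displacement -/

/-- kernel: inside the fundamental domain the minimal representative of `z mod N` is `z`: `2|z| < N ⇒ valMinAbs(z̄) = z`.
[cite: Balaban1983Higgs3, (3.27) p.441] -/
theorem valMinAbs_intCast_of_two_mul_lt (N : ℕ) [NeZero N] (z : ℤ) (hz : 2 * z.natAbs < N) :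
    (z : ZMod N).valMinAbs = z := by
  rw [ZMod.valMinAbs_spec]
  refine ⟨rfl, ?_, ?_⟩ <;> omega

/-- kernel: the wrapped displacement `ξ·valMinAbs(ū_ν)` is dominated by `ξ|u|_∞`. [cite: Balaban1983Higgs3, (3.27) p.441] -/
theorem abs_wrapDisp_le (hξ : 0 ≤ ξ) (N : ℕ) [NeZero N] (ν : Fin d) (u : ZSite d) :
    |ξ * ((((u ν : ℤ) : ZMod N).valMinAbs : ℤ) : ℝ)| ≤ ξ * (supNorm u : ℝ) := by
  rw [abs_mul, abs_of_nonneg hξ]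
  refine mul_le_mul_of_nonneg_left ?_ hξ
  rw [← Int.cast_abs, Int.abs_eq_natAbs, Int.cast_natCast, Nat.cast_le]
  -- the minimal representative of `z mod N` is not longer than `z` (`ZMod.natAbs_min_of_le_div_two`)
  exact (ZMod.natAbs_min_of_le_div_two N _ _ (ZMod.coe_valMinAbs _) (ZMod.natAbs_valMinAbs_le _)).trans (le_supNorm u ν)

/-- kernel: the ℤ^d displacement `ξu_ν` is dominated by `ξ|u|_∞`. [cite: Balaban1983Higgs3, (3.27) p.441] -/
theorem abs_coordDisp_le (hξ : 0 ≤ ξ) (ν : Fin d) (u : ZSite d) : |ξ * ((u ν : ℤ) : ℝ)| ≤ ξ * (supNorm u : ℝ) := by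
  rw [abs_mul, abs_of_nonneg hξ]
  refine mul_le_mul_of_nonneg_left ?_ hξ
  rw [← Int.cast_abs, Int.abs_eq_natAbs, Int.cast_natCast, Nat.cast_le]
  exact le_supNorm u ν

/-- kernel: inside the fundamental domain (`2|u|_∞ < N`) the wrapped displacement IS `ξu_ν`. [cite: Balaban1983Higgs3, (3.27) p.441] -/
theorem wrapDisp_sub_coordDisp_eq_zero (ξ : ℝ) (N : ℕ) [NeZero N] (ν : Fin d) (u : ZSite d) (hu : 2 * supNorm u < N) :
    ξ * ((((u ν : ℤ) : ZMod N).valMinAbs : ℤ) : ℝ) - ξ * ((u ν : ℤ) : ℝ) = 0 := by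
  rw [valMinAbs_intCast_of_two_mul_lt N (u ν) (lt_of_le_of_lt (Nat.mul_le_mul_left 2 (le_supNorm u ν)) hu), sub_self]

/-- kernel: the wrap correction is at most `2ξ|u|_∞` everywhere. [cite: Balaban1983Higgs3, (3.27) p.441] -/
theorem abs_wrapDisp_sub_coordDisp_le (hξ : 0 ≤ ξ) (N : ℕ) [NeZero N] (ν : Fin d) (u : ZSite d) :
    |ξ * ((((u ν : ℤ) : ZMod N).valMinAbs : ℤ) : ℝ) - ξ * ((u ν : ℤ) : ℝ)| ≤ 2 * (ξ * (supNorm u : ℝ)) :=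
  (abs_sub _ _).trans (by linarith [abs_wrapDisp_le hξ N ν u, abs_coordDisp_le hξ ν u])

/-! ## §2 Profiles of the displacement-weighted kernels -/

/-- kernel: a displacement weight `|η(u)| ≤ ξ|u|_∞` costs exactly one power of the profile:
`|g(u)| ≤ c(ξ max(1,|u|_∞))^{−(q+1)}e^{−ξ|u|_∞/2} ⇒ |g(u)η(u)| ≤ c(ξ max(1,|u|_∞))^{−q}e^{−ξ|u|_∞/2}`. [cite: Balaban1983Higgs3, (3.27) p.441] -/
theorem abs_mul_weight_le_profile (hξ : 0 < ξ) {cg : ℝ} (hcg : 0 ≤ cg) {q : ℕ} (g η : ZSite d → ℝ)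
    (hg : ∀ u, |g u| ≤ cg * (((ξ * max 1 (supNorm u : ℝ)) ^ (q + 1))⁻¹ * Real.exp (-(1 / 2 * (ξ * (supNorm u : ℝ))))))
    (hη : ∀ u, |η u| ≤ ξ * (supNorm u : ℝ)) (u : ZSite d) :
    |g u * η u| ≤ cg * (((ξ * max 1 (supNorm u : ℝ)) ^ q)⁻¹ * Real.exp (-(1 / 2 * (ξ * (supNorm u : ℝ))))) := by
  set M : ℝ := ξ * max 1 (supNorm u : ℝ) with hM
  have hM0 : 0 < M := by positivity
  have hle : ξ * (supNorm u : ℝ) ≤ M := mul_le_mul_of_nonneg_left (le_max_right _ _) hξ.le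
  rw [abs_mul]
  calc |g u| * |η u| ≤ cg * ((M ^ (q + 1))⁻¹ * Real.exp (-(1 / 2 * (ξ * (supNorm u : ℝ))))) * M :=
        mul_le_mul (hg u) ((hη u).trans hle) (abs_nonneg _) (by positivity)
    _ = cg * ((M ^ q)⁻¹ * Real.exp (-(1 / 2 * (ξ * (supNorm u : ℝ))))) * (M⁻¹ * M) := by rw [pow_succ, mul_inv]; ring
    _ = cg * ((M ^ q)⁻¹ * Real.exp (-(1 / 2 * (ξ * (supNorm u : ℝ))))) := by rw [inv_mul_cancel₀ hM0.ne', mul_one]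

/-- **The second-order kernel at EVERY site** (p20's sharp bound `B3CxiAllSitesProfiles`, both index cases): on ξℤ³ with `0 < ξ ≤ 1`,
`|(∂^ξ_{μ′}∂^{ξ*}_μC^ξ)(u)| ≤ 61000·(ξ max(1,|u|_∞))^{−3}·e^{−ξ|u|_∞/2}` — the mixed second difference for `μ′ ≠ μ`, minus the centred
pure one for `μ′ = μ`. [cite: Balaban1983Higgs3, (3.27) p.441] -/
theorem abs_d2Z_Cxi_le_profile (hd : d = 3) (hξ : 0 < ξ) (hξ1 : ξ ≤ 1) (μ' μ : Fin d) (u : ZSite d) :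
    |pdiffZ ξ⁻¹ μ' (pdiffAdjZ ξ⁻¹ μ (Cxi d ξ)) u| ≤
      61000 * (((ξ * max 1 (supNorm u : ℝ)) ^ 3)⁻¹ * Real.exp (-(1 / 2 * (ξ * (supNorm u : ℝ))))) := by
  subst hd
  have hξne : ξ ≠ 0 := hξ.ne'
  have hξ2 : (0 : ℝ) < ξ ^ 2 := pow_pos hξ 2
  have hexp : -(ξ * (supNorm u : ℝ) / 2) = -(1 / 2 * (ξ * (supNorm u : ℝ))) := by ring
  have hE : pdiffZ ξ⁻¹ μ' (pdiffAdjZ ξ⁻¹ μ (Cxi 3 ξ)) u =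
      (ξ ^ 2)⁻¹ * (Cxi 3 ξ (u + unitVec μ' - unitVec μ) - Cxi 3 ξ (u + unitVec μ') - Cxi 3 ξ (u - unitVec μ) + Cxi 3 ξ u) := by
    simp only [pdiffZ, pdiffAdjZ]
    ring
  rw [hE, abs_mul, abs_of_pos (inv_pos.2 hξ2)]
  have key : |Cxi 3 ξ (u + unitVec μ' - unitVec μ) - Cxi 3 ξ (u + unitVec μ') - Cxi 3 ξ (u - unitVec μ) + Cxi 3 ξ u| ≤
      61000 * ξ ^ 2 * (((ξ * max 1 (supNorm u : ℝ)) ^ 3)⁻¹ * Real.exp (-(1 / 2 * (ξ * (supNorm u : ℝ))))) := by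
    by_cases hne : μ' = μ
    · subst hne
      have h := abs_Cxi_pureDiff_profile_sup hξ hξ1 u μ'
      rw [hexp] at h
      rw [add_sub_cancel_right, show Cxi 3 ξ u - Cxi 3 ξ (u + unitVec μ') - Cxi 3 ξ (u - unitVec μ') + Cxi 3 ξ u =
        -(Cxi 3 ξ (u + unitVec μ') - 2 * Cxi 3 ξ u + Cxi 3 ξ (u - unitVec μ')) by ring, abs_neg]
      exact h
    · have h := abs_Cxi_mixedDiff_profile_sup hξ hξ1 u hne (c := 1) (c' := -1) (Or.inl rfl) (Or.inr rfl)
      simp only [hexp, one_smul, neg_one_smul, ← sub_eq_add_neg] at h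
      exact h
  calc _ ≤ (ξ ^ 2)⁻¹ * (61000 * ξ ^ 2 * (((ξ * max 1 (supNorm u : ℝ)) ^ 3)⁻¹ * Real.exp (-(1 / 2 * (ξ * (supNorm u : ℝ)))))) :=
        mul_le_mul_of_nonneg_left key (inv_pos.2 hξ2).le
    _ = 61000 * (((ξ * max 1 (supNorm u : ℝ)) ^ 3)⁻¹ * Real.exp (-(1 / 2 * (ξ * (supNorm u : ℝ))))) * ((ξ ^ 2)⁻¹ * ξ ^ 2) := by
        ring
    _ = _ := by rw [inv_mul_cancel₀ hξ2.ne', mul_one]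

/-! ## §3 The boundary layer and the coordinate sections of the `k = 0` term -/

/-- **The boundary layer of the `k = 0` term is exponentially small.**  For all-sites profile kernels `f, g` of total order
`p + q = 4` and a correction `θ` supported on `2|u|_∞ ≥ N` with `|θ(u)| ≤ 2ξ|u|_∞` (the difference between the wrapped torus
displacement and the ℤ³ one), `Σ'_w f(w)g(−w)θ(−w)` is summable and `ξ³Σ'_w |f(w)g(−w)θ(−w)| ≤ 26656·c_f c_g·e^{−ξN/4}`
(`0 < ξ ≤ 1`, `ξN ≥ 1`, `d = 3`). [cite: Balaban1983Higgs3, (3.27) p.441] -/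
theorem boundary_summable_and_le (hd : d = 3) (hξ : 0 < ξ) (hξ1 : ξ ≤ 1) {N : ℕ} (hN : 1 ≤ ξ * N)
    {cf cg : ℝ} (hcf : 0 ≤ cf) (hcg : 0 ≤ cg) {p q : ℕ} (hpq : p + q = 4) (f g θ : ZSite d → ℝ)
    (hf : ∀ u, |f u| ≤ cf * (((ξ * max 1 (supNorm u : ℝ)) ^ p)⁻¹ * Real.exp (-(1 / 2 * (ξ * (supNorm u : ℝ))))))
    (hg : ∀ u, |g u| ≤ cg * (((ξ * max 1 (supNorm u : ℝ)) ^ q)⁻¹ * Real.exp (-(1 / 2 * (ξ * (supNorm u : ℝ))))))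
    (hθ0 : ∀ u, 2 * supNorm u < N → θ u = 0) (hθ : ∀ u, |θ u| ≤ 2 * (ξ * (supNorm u : ℝ))) :
    Summable (fun w => f w * (g (-w) * θ (-w))) ∧
      ξ ^ 3 * ∑' w, |f w * (g (-w) * θ (-w))| ≤ 26656 * (cf * cg) * Real.exp (-(ξ * N / 4)) := by
  subst hd
  have hξ3 : (0 : ℝ) < ξ ^ 3 := pow_pos hξ 3
  obtain ⟨hPs, hPle⟩ := tsum_profile_le (d := 3) rfl hξ hξ1 (by norm_num : (0 : ℝ) < 1 / 2)
    (by norm_num : (1 : ℝ) / 2 ≤ 1) (le_rfl : 2 ≤ 2)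
  have hpt : ∀ w : ZSite 3, |f w * (g (-w) * θ (-w))| ≤
      4 * (cf * cg) * Real.exp (-(ξ * N / 4)) * (ξ ^ 3)⁻¹ *
        (ξ ^ 3 * (((ξ * max 1 (supNorm w : ℝ)) ^ 2)⁻¹ * Real.exp (-(1 / 2 * (ξ * (supNorm w : ℝ)))))) := by
    intro w
    by_cases hw : 2 * supNorm w < N
    · rw [hθ0 (-w) (by rwa [supNorm_neg]), mul_zero, mul_zero, abs_zero]; positivity
    · rw [not_lt] at hw
      have hfw := hf w
      have hgw := hg (-w)
      have hθw := hθ (-w)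
      rw [supNorm_neg] at hgw hθw
      set M : ℝ := ξ * max 1 (supNorm w : ℝ) with hM
      set ee : ℝ := Real.exp (-(1 / 2 * (ξ * (supNorm w : ℝ)))) with hee
      have hn2 : (N : ℝ) ≤ 2 * (supNorm w : ℝ) := by exact_mod_cast hw
      have hM0 : 0 < M := by positivity
      have hnM : ξ * (supNorm w : ℝ) ≤ M := mul_le_mul_of_nonneg_left (le_max_right _ _) hξ.le
      have hξn : ξ * (N : ℝ) ≤ 2 * (ξ * (supNorm w : ℝ)) := by nlinarith
      have hM12 : 1 / 2 ≤ M := by linarith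
      have he0 : 0 < ee := Real.exp_pos _
      have hMinv : (M ^ 3)⁻¹ ≤ 2 * (M ^ 2)⁻¹ := by
        rw [show (M ^ 3)⁻¹ = (M ^ 2)⁻¹ * M⁻¹ by rw [pow_succ, mul_inv], mul_comm]
        refine mul_le_mul_of_nonneg_right ?_ (by positivity)
        rw [inv_le_comm₀ hM0 two_pos]; linarith
      have heexp : ee * ee ≤ Real.exp (-(ξ * N / 4)) * ee := by
        refine mul_le_mul_of_nonneg_right (Real.exp_le_exp.2 ?_) he0.le
        linarith
      have hprod : |f w| * |g (-w)| ≤ cf * cg * ((M ^ 4)⁻¹ * (ee * ee)) := by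
        calc |f w| * |g (-w)| ≤ (cf * ((M ^ p)⁻¹ * ee)) * (cg * ((M ^ q)⁻¹ * ee)) :=
              mul_le_mul hfw hgw (abs_nonneg _) (by positivity)
          _ = cf * cg * ((M ^ p * M ^ q)⁻¹ * (ee * ee)) := by rw [mul_inv]; ring
          _ = cf * cg * ((M ^ 4)⁻¹ * (ee * ee)) := by rw [← pow_add, hpq]
      have hM43 : (M ^ 4)⁻¹ * M = (M ^ 3)⁻¹ := by
        rw [show M ^ 4 = M ^ 3 * M by ring, mul_inv, mul_assoc, inv_mul_cancel₀ hM0.ne', mul_one]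
      rw [abs_mul, abs_mul]
      calc |f w| * (|g (-w)| * |θ (-w)|) = (|f w| * |g (-w)|) * |θ (-w)| := by ring
        _ ≤ (cf * cg * ((M ^ 4)⁻¹ * (ee * ee))) * (2 * M) :=
            mul_le_mul hprod (hθw.trans (by linarith)) (abs_nonneg _) (by positivity)
        _ = 2 * (cf * cg) * ((M ^ 4)⁻¹ * M) * (ee * ee) := by ring
        _ = 2 * (cf * cg) * (M ^ 3)⁻¹ * (ee * ee) := by rw [hM43]
        _ ≤ 2 * (cf * cg) * (2 * (M ^ 2)⁻¹) * (Real.exp (-(ξ * N / 4)) * ee) :=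
            mul_le_mul (mul_le_mul_of_nonneg_left hMinv (by positivity)) heexp (by positivity) (by positivity)
        _ = 4 * (cf * cg) * Real.exp (-(ξ * N / 4)) * ((ξ ^ 3)⁻¹ * ξ ^ 3) * ((M ^ 2)⁻¹ * ee) := by
            rw [inv_mul_cancel₀ hξ3.ne']; ring
        _ = _ := by ring
  have hmaj : Summable fun w : ZSite 3 => 4 * (cf * cg) * Real.exp (-(ξ * N / 4)) * (ξ ^ 3)⁻¹ *
      (ξ ^ 3 * (((ξ * max 1 (supNorm w : ℝ)) ^ 2)⁻¹ * Real.exp (-(1 / 2 * (ξ * (supNorm w : ℝ)))))) :=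
    hPs.mul_left _
  have hsum : Summable fun w : ZSite 3 => f w * (g (-w) * θ (-w)) :=
    Summable.of_norm_bounded hmaj fun w => by rw [Real.norm_eq_abs]; exact hpt w
  refine ⟨hsum, ?_⟩
  have habs : Summable fun w : ZSite 3 => |f w * (g (-w) * θ (-w))| := hsum.abs
  calc ξ ^ 3 * ∑' w, |f w * (g (-w) * θ (-w))|
      ≤ ξ ^ 3 * ∑' w : ZSite 3, 4 * (cf * cg) * Real.exp (-(ξ * N / 4)) * (ξ ^ 3)⁻¹ *
          (ξ ^ 3 * (((ξ * max 1 (supNorm w : ℝ)) ^ 2)⁻¹ * Real.exp (-(1 / 2 * (ξ * (supNorm w : ℝ)))))) :=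
        mul_le_mul_of_nonneg_left (habs.tsum_le_tsum hpt hmaj) hξ3.le
    _ = 4 * (cf * cg) * Real.exp (-(ξ * N / 4)) * ((ξ ^ 3 * (ξ ^ 3)⁻¹) *
          ∑' w : ZSite 3, ξ ^ 3 * (((ξ * max 1 (supNorm w : ℝ)) ^ 2)⁻¹ * Real.exp (-(1 / 2 * (ξ * (supNorm w : ℝ)))))) := by
        rw [tsum_mul_left]; ring
    _ ≤ 4 * (cf * cg) * Real.exp (-(ξ * N / 4)) * (1 * (833 / (1 / 2) ^ 3)) := by
        rw [mul_inv_cancel₀ hξ3.ne']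
        gcongr
    _ = 26656 * (cf * cg) * Real.exp (-(ξ * N / 4)) := by ring

/-- **The `k = 0` term contains r15's left side of (3.27) at `y = 0`**: `lhs327 3 ξ τ 0 μ μ′ ν = τ·ξ³·(−Σ'_w (∂^{ξ*}_{μ′}C^ξ)(w)
(∂^{ξ*}_μC^ξ)(−w)·ξ(−w)_ν + Σ'_w C^ξ(w)(∂^ξ_{μ′}∂^{ξ*}_μC^ξ)(−w)·ξ(−w)_ν)` (reindexing `y′ = −w`; the two sections are summable by the
profile bounds). [cite: Balaban1983Higgs3, (3.27) p.441] -/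
theorem lhs327_zero_eq (hd : d = 3) (hξ : 0 < ξ) (hξ1 : ξ ≤ 1) (τ : ℝ) (μ μ' ν : Fin d) :
    lhs327 d ξ τ 0 μ μ' ν =
      τ * (ξ ^ d * (-(∑' w : ZSite d, pdiffAdjZ ξ⁻¹ μ' (Cxi d ξ) w *
          (pdiffAdjZ ξ⁻¹ μ (Cxi d ξ) (-w) * (ξ * (((-w) ν : ℤ) : ℝ)))) +
        ∑' w : ZSite d, Cxi d ξ w * (pdiffZ ξ⁻¹ μ' (pdiffAdjZ ξ⁻¹ μ (Cxi d ξ)) (-w) * (ξ * (((-w) ν : ℤ) : ℝ))))) := by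
  set C := Cxi d ξ with hC
  set A := pdiffAdjZ ξ⁻¹ μ C with hA
  set A' := pdiffAdjZ ξ⁻¹ μ' C with hA'
  set E := pdiffZ ξ⁻¹ μ' (pdiffAdjZ ξ⁻¹ μ C) with hE
  have hz : 2 * (0 : ℝ) ≤ (supNorm (0 : ZSite d) : ℝ) := by rw [supNorm_zero]; norm_num
  have hgA := abs_mul_weight_le_profile hξ (by norm_num : (0 : ℝ) ≤ 900) (q := 1) A (fun u : ZSite d => ξ * ((u ν : ℤ) : ℝ))
    (abs_pdiffAdjZ_Cxi_le_profile hd hξ hξ1 μ) (abs_coordDisp_le hξ.le ν)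
  have hgE := abs_mul_weight_le_profile hξ (by norm_num : (0 : ℝ) ≤ 61000) (q := 2) E (fun u : ZSite d => ξ * ((u ν : ℤ) : ℝ))
    (abs_d2Z_Cxi_le_profile hd hξ hξ1 μ' μ) (abs_coordDisp_le hξ.le ν)
  have hsA := (pair_far_bound hd hξ hξ1 (by norm_num) (by norm_num) le_rfl (by norm_num : 1 ≤ 2) A' _
    (abs_pdiffAdjZ_Cxi_le_profile hd hξ hξ1 μ') hgA 0 hz).1
  have hsB := (pair_far_bound hd hξ hξ1 (by norm_num) (by norm_num) (by norm_num : 1 ≤ 2) le_rfl C _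
    (abs_Cxi_le_profile hd hξ hξ1) hgE 0 hz).1
  simp only [zero_sub] at hsA hsB
  have h1 : Summable fun w : ZSite d => A' w * (A (-w) * (ξ * (((-w) ν : ℤ) : ℝ))) :=
    Summable.of_abs (hsA.congr fun w => by rw [← abs_mul])
  have h2 : Summable fun w : ZSite d => C w * (E (-w) * (ξ * (((-w) ν : ℤ) : ℝ))) :=
    Summable.of_abs (hsB.congr fun w => by rw [← abs_mul])
  have hsum : ∑' y' : ZSite d, ξ ^ d *
      (-(A' (0 - y') * A (y' - 0) * (ξ * (((y' ν : ℤ) : ℝ) - (((0 : ZSite d) ν : ℤ) : ℝ)))) +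
        C (0 - y') * E (y' - 0) * (ξ * (((y' ν : ℤ) : ℝ) - (((0 : ZSite d) ν : ℤ) : ℝ)))) =
      ξ ^ d * (-(∑' w : ZSite d, A' w * (A (-w) * (ξ * (((-w) ν : ℤ) : ℝ)))) +
        ∑' w : ZSite d, C w * (E (-w) * (ξ * (((-w) ν : ℤ) : ℝ)))) := by
    rw [← (Equiv.neg (ZSite d)).tsum_eq]
    simp only [Equiv.neg_apply, zero_sub, sub_zero, neg_neg, Pi.zero_apply, Int.cast_zero]
    rw [tsum_mul_left]
    congr 1
    calc ∑' x : ZSite d, (-(A' x * A (-x) * (ξ * (((-x) ν : ℤ) : ℝ))) + C x * E (-x) * (ξ * (((-x) ν : ℤ) : ℝ)))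
        = ∑' x : ZSite d, (-(A' x * (A (-x) * (ξ * (((-x) ν : ℤ) : ℝ)))) + C x * (E (-x) * (ξ * (((-x) ν : ℤ) : ℝ)))) :=
          tsum_congr fun x => by ring
      _ = ∑' x : ZSite d, -(A' x * (A (-x) * (ξ * (((-x) ν : ℤ) : ℝ)))) +
            ∑' x : ZSite d, C x * (E (-x) * (ξ * (((-x) ν : ℤ) : ℝ))) := h1.neg.tsum_add h2
      _ = _ := by rw [tsum_neg]
  unfold lhs327
  rw [hsum]

end

end Literature.MathematicalPhysics.QuantumFieldTheory.Balaban1983to89.B3DisplacementWeightedPairSums
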